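import Summits.BirchSwinnertonDyer.BirchSwinnertonDyer.Theorems.ByReductionTypeAtTwoFineSelmerConjAAtTwoAdditivePotGoodNarrowRankCertificate63644Units
import Summits.BirchSwinnertonDyer.BirchSwinnertonDyer.Theorems.ByReductionTypeAtTwoFineSelmerConjAAtTwoAdditivePotGoodNarrowDefectCertificate1257Embeddings
import HarnessLib

/-!
# Route `ByReductionTypeAtTwo` (rung K4), crux C1″ `FineSelmerConjAAtTwoAdditivePotGood` (item stmt-BirchSwinnertonDyer-22615):
# THE LAYER-`1` FIELD `A = ℚ(θ) ⊔ ℚ_1 = ℚ(θ, √2)` OF THE CUBIC FIELD OF DISCRIMINANT `63644` (`θ³ − θ² − 47θ + 95 = 0`, point field of the census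
# row `445508b1`), PART A — totally real sextic, its six real embeddings by COUNTING, and the non-square `u₀` there (KERNEL)
# (a `--supports 22615` file; seat `bsd-2adic-k4-w1` GEN 10; sequel of `…NarrowRankCertificate63644Units`; part B assembles the unit signatures,
# the parity of `h(A)` and `[Cl⁺(A) : Cl⁺(A)²] = 2` for the narrow-Fukuda door)

HONEST FRAMING (cell `bsd-2adic`, D-0036/D-0054/D-0152): KERNEL theorems about ONE totally real sextic field `A = ℚ(θ) ⊔ ℚ_1 = ℚ(θ, √2)`
(`ℚ_1` the first layer of the cyclotomic `ℤ₂`-extension of `ℚ`); no elliptic curve, no named fact, no `sorry`, no definition. Closes nothing at the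
`∀`-level; nothing booked; BSD is not proved by any of this.

Differences with the `d = 1257` sibling (`…NarrowDefectCertificate1257Embeddings`, GEN 9): the field `ℚ(θ)` has TWO primes above `2`, so the basic
data of `A` (totally real of degree `6`) is taken from the restricted cyclotomic tower WITHOUT the one-prime hypothesis (`isTotallyReal_layer`,
`finrank_layer_restrict`), and the non-square unit is `u₀ = 1027839 − 26042θ − 23048θ²` of the layer-`0` certificate (`unitCertificate_adjoin_d63644`).

* `layer_one_basics_d63644` — `A` totally real, `[A : ℚ] = 6`, `[ℚ(θ) : ℚ] = 3`.
* `exists_ringHom_sup_layer_one_d63644` — every pair `(φ, ±√2)` is realised by a real embedding of `A` (counting: `ρ ↦ (ρ|_{ℚ(θ)}, ρ(√2))` is injective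
  into the `6`-set `Emb(ℚ(θ)) × {±√2}`).
* `not_exists_sq_eq_u0_sup_layer_one_d63644` — `u₀` is not the square of a unit of `𝓞 A` (`σ`-trick + `N(2u₀) = ±8` is not a rational square).

References: [FrohlichTaylor1990] Ch. V §1 (1.10)–(1.13); [Cohen1993] §4.1.3; [Washington1997] §13.1 (`ℚ_1 = ℚ(√2)`), Prop. 13.2.
-/

set_option autoImplicit false
-- sibling precedent: the directory name repeats the summit name
set_option linter.dupNamespace false

noncomputable section

open scoped Classical IntermediateField NumberField

namespace Summit.BirchSwinnertonDyer.BirchSwinnertonDyer.Theorems.AddKatoTwo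

open Polynomial IsDedekindDomain NumberField Field IntermediateField
  Literature.NumberTheory.EllipticCurves Literature.NumberTheory.EllipticCurves.ZpExtension
  Literature.NumberTheory.IwasawaTheory Literature.NumberTheory.NumberFields
  Literature.NumberTheory.GaloisRepresentations Literature.Geometry.Kaehler.ComplexTorus

variable {θ : AlgebraicClosure ℚ}

set_option maxHeartbeats 400000 in
/-- **The basic data of `A = ℚ(θ) ⊔ ℚ_1` for `d = 63644`: totally real, degree `6`, and `[ℚ(θ):ℚ] = 3`** — from the restricted cyclotomic
`ℤ₂`-tower of `ℚ(θ)` (odd degree, so the cyclotomic character restricts onto): its first layer is `≅ ℚ(θ) ⊔ ℚ_1`, totally real as a layer of a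
`ℤ₂`-extension of a totally real field, of degree `3·2`. No hypothesis on the primes above `2`. [cite: Washington1997, §13.1 and Prop. 13.2] -/
theorem layer_one_basics_d63644 (hθ : aeval θ (Cubic.toPoly ⟨1, ((-1 : ℤ) : ℚ), ((-47 : ℤ) : ℚ), ((95 : ℤ) : ℚ)⟩) = 0) :
    haveI : FiniteDimensional ℚ ↥ℚ⟮θ⟯ :=
      IntermediateField.adjoin.finiteDimensional ⟨_, Cubic.monic_of_a_eq_one', by rwa [← aeval_def]⟩
    haveI : FiniteDimensional ℚ ↥((CyclotomicZp.zpExtension 2).layer 1) := (CyclotomicZp.zpExtension 2).finiteDimensional_layer_holds 1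
    haveI : NumberField ↥(ℚ⟮θ⟯ ⊔ (CyclotomicZp.zpExtension 2).layer 1) := NumberField.mk
    IsTotallyReal ↥(ℚ⟮θ⟯ ⊔ (CyclotomicZp.zpExtension 2).layer 1) ∧
      Module.finrank ℚ ↥(ℚ⟮θ⟯ ⊔ (CyclotomicZp.zpExtension 2).layer 1) = 6 ∧ Module.finrank ℚ ↥ℚ⟮θ⟯ = 3 := by
  haveI : FiniteDimensional ℚ ↥ℚ⟮θ⟯ :=
    IntermediateField.adjoin.finiteDimensional ⟨_, Cubic.monic_of_a_eq_one', by rwa [← aeval_def]⟩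
  haveI : FiniteDimensional ℚ ↥((CyclotomicZp.zpExtension 2).layer 1) := (CyclotomicZp.zpExtension 2).finiteDimensional_layer_holds 1
  haveI : NumberField ↥ℚ⟮θ⟯ := NumberField.mk
  haveI : NumberField ↥(ℚ⟮θ⟯ ⊔ (CyclotomicZp.zpExtension 2).layer 1) := NumberField.mk
  haveI : IsTotallyReal ↥ℚ⟮θ⟯ := isTotallyReal_adjoin_d63644 hθ
  set κ := CyclotomicZp.zpExtension 2 with hκdef
  have h3 : Module.finrank ℚ ↥ℚ⟮θ⟯ = 3 := finrank_adjoin_eq_three_of_irreducible irreducible_cubic_d63644p_min hθ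
  have hodd3 : Odd (Module.finrank ℚ ↥ℚ⟮θ⟯) := by rw [h3]; decide
  have hsurj := surjective_comp_absGaloisRestrict_cyclotomicZp_of_odd ℚ⟮θ⟯ hodd3
  set κE := κ.restrict ↥ℚ⟮θ⟯ hsurj with hκE
  haveI : FiniteDimensional ↥ℚ⟮θ⟯ (κE.layer 1) := κE.finiteDimensional_layer_holds 1
  haveI : NumberField (κE.layer 1) := NumberField.of_module_finite ↥ℚ⟮θ⟯ _
  obtain ⟨f⟩ := nonempty_algEquiv_layer_restrict_fieldRange_sup_layer κ ↥ℚ⟮θ⟯ hsurj (ℚ⟮θ⟯).val 1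
  have hrange : (ℚ⟮θ⟯).val.fieldRange ⊔ κ.layer 1 = ℚ⟮θ⟯ ⊔ κ.layer 1 := by rw [fieldRange_val]
  set e : ↥(κE.layer 1) ≃ₐ[ℚ] ↥(ℚ⟮θ⟯ ⊔ κ.layer 1) := f.trans (equivOfEq hrange) with hedef
  haveI : IsTotallyReal ↥(κE.layer 1) := isTotallyReal_layer κE 1
  refine ⟨IsTotallyReal.ofRingEquiv e.toRingEquiv, ?_, h3⟩
  rw [← e.toLinearEquiv.finrank_eq, finrank_layer_restrict κ ↥ℚ⟮θ⟯ hsurj 1, h3]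
  norm_num

set_option maxHeartbeats 400000 in
/-- **The real embeddings of `A = ℚ(θ) ⊔ ℚ_1` (`d = 63644`) realise every pair `(φ, ±√2)`**, `φ` a real embedding of `ℚ(θ)`: `A` is
totally real of degree `6`, `ρ ↦ (ρ|_{ℚ(θ)}, ρ(√2))` is injective (`A = ℚ(θ)(√2)`, `√2 ∉ ℚ(θ)` by odd degree) with image in the `6`-set
`Emb(ℚ(θ)) × {±√2}`. [cite: FrohlichTaylor1990, Ch. V §1 ("the embeddings N ↪ ℝ"), p. 163] [cite: Washington1997, §13.1] [cite: Cohen1993, §4.1.3] -/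
theorem exists_ringHom_sup_layer_one_d63644 (hθ : aeval θ (Cubic.toPoly ⟨1, ((-1 : ℤ) : ℚ), ((-47 : ℤ) : ℚ), ((95 : ℤ) : ℚ)⟩) = 0)
    {t : AlgebraicClosure ℚ} (ht : t ∈ (CyclotomicZp.zpExtension 2).layer 1) (ht2 : t ^ 2 = 2)
    (φ : ↥ℚ⟮θ⟯ →+* ℝ) (y : ℝ) (hy : y = Real.sqrt 2 ∨ y = -Real.sqrt 2) :
    ∃ ρ : ↥(ℚ⟮θ⟯ ⊔ (CyclotomicZp.zpExtension 2).layer 1) →+* ℝ,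
      (∀ c : ↥ℚ⟮θ⟯, ρ (inclusion (le_sup_left : ℚ⟮θ⟯ ≤ ℚ⟮θ⟯ ⊔ (CyclotomicZp.zpExtension 2).layer 1) c) = φ c) ∧
      ρ ⟨t, (le_sup_right : (CyclotomicZp.zpExtension 2).layer 1 ≤ _) ht⟩ = y := by
  haveI : FiniteDimensional ℚ ↥ℚ⟮θ⟯ :=
    IntermediateField.adjoin.finiteDimensional ⟨_, Cubic.monic_of_a_eq_one', by rwa [← aeval_def]⟩
  haveI : FiniteDimensional ℚ ↥((CyclotomicZp.zpExtension 2).layer 1) := (CyclotomicZp.zpExtension 2).finiteDimensional_layer_holds 1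
  haveI : NumberField ↥ℚ⟮θ⟯ := NumberField.mk
  haveI : NumberField ↥(ℚ⟮θ⟯ ⊔ (CyclotomicZp.zpExtension 2).layer 1) := NumberField.mk
  obtain ⟨hreal, hfinA, h3⟩ := layer_one_basics_d63644 hθ
  haveI := hreal
  have hKA : ℚ⟮θ⟯ ≤ ℚ⟮θ⟯ ⊔ ((CyclotomicZp.zpExtension 2).layer 1) := le_sup_left
  have htA : t ∈ ℚ⟮θ⟯ ⊔ ((CyclotomicZp.zpExtension 2).layer 1) := (le_sup_right : ((CyclotomicZp.zpExtension 2).layer 1) ≤ ℚ⟮θ⟯ ⊔ ((CyclotomicZp.zpExtension 2).layer 1)) ht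
  set t' : ↥(ℚ⟮θ⟯ ⊔ ((CyclotomicZp.zpExtension 2).layer 1)) := ⟨t, htA⟩ with ht'def
  have ht'2 : t' ^ 2 = 2 := by
    apply (algebraMap ↥(ℚ⟮θ⟯ ⊔ ((CyclotomicZp.zpExtension 2).layer 1)) (AlgebraicClosure ℚ)).injective
    rw [map_pow, map_ofNat]
    exact ht2
  letI : Algebra ℚ⟮θ⟯ ↥(ℚ⟮θ⟯ ⊔ ((CyclotomicZp.zpExtension 2).layer 1)) := (inclusion hKA).toRingHom.toAlgebra
  have halg : ∀ c : ℚ⟮θ⟯, algebraMap ℚ⟮θ⟯ ↥(ℚ⟮θ⟯ ⊔ ((CyclotomicZp.zpExtension 2).layer 1)) c = inclusion hKA c := fun _ => rfl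
  haveI : IsScalarTower ℚ ℚ⟮θ⟯ ↥(ℚ⟮θ⟯ ⊔ ((CyclotomicZp.zpExtension 2).layer 1)) := IsScalarTower.of_algebraMap_eq fun q => ((inclusion hKA).commutes q).symm
  haveI : Module.Finite ℚ⟮θ⟯ ↥(ℚ⟮θ⟯ ⊔ ((CyclotomicZp.zpExtension 2).layer 1)) := Module.Finite.of_restrictScalars_finite ℚ ℚ⟮θ⟯ _
  have hdeg : Module.finrank ℚ⟮θ⟯ ↥(ℚ⟮θ⟯ ⊔ ((CyclotomicZp.zpExtension 2).layer 1)) = 2 := by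
    have htower := Module.finrank_mul_finrank ℚ ℚ⟮θ⟯ ↥(ℚ⟮θ⟯ ⊔ ((CyclotomicZp.zpExtension 2).layer 1))
    rw [h3, hfinA] at htower
    omega
  -- `√2 ∉ ℚ⟮θ⟯` (odd degree)
  have htK : t' ∉ Set.range (algebraMap ℚ⟮θ⟯ ↥(ℚ⟮θ⟯ ⊔ ((CyclotomicZp.zpExtension 2).layer 1))) := by
    rintro ⟨c, hc⟩
    have hc2 : c ^ 2 = 2 := by
      apply (algebraMap ℚ⟮θ⟯ ↥(ℚ⟮θ⟯ ⊔ ((CyclotomicZp.zpExtension 2).layer 1))).injective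
      rw [map_pow, hc, ht'2, map_ofNat]
    have hcQ : (c : AlgebraicClosure ℚ) ^ 2 = 2 := by
      have := congrArg (fun z : ↥ℚ⟮θ⟯ => (z : AlgebraicClosure ℚ)) hc2
      push_cast at this
      exact this
    have hcint : IsIntegral ℚ (c : AlgebraicClosure ℚ) := ⟨X ^ 2 - C 2, monic_X_pow_sub_C _ two_ne_zero, by simp [hcQ]⟩
    have hcnot : (c : AlgebraicClosure ℚ) ∉ (algebraMap ℚ (AlgebraicClosure ℚ)).range := by
      rintro ⟨q, hq⟩
      have h1 : (algebraMap ℚ (AlgebraicClosure ℚ)) (q ^ 2) = algebraMap ℚ (AlgebraicClosure ℚ) 2 := by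
        rw [map_pow, hq, hcQ, map_ofNat]
      have h2 : q ^ 2 = 2 := (algebraMap ℚ (AlgebraicClosure ℚ)).injective h1
      have hq2 : ((q : ℝ)) ^ 2 = 2 := by exact_mod_cast h2
      exact irrational_sqrt_two ⟨|q|, by rw [Rat.cast_abs, ← Real.sqrt_sq_eq_abs, hq2]⟩
    have hdeg2 : Module.finrank ℚ ↥ℚ⟮(c : AlgebraicClosure ℚ)⟯ = 2 := by
      rw [IntermediateField.adjoin.finrank hcint]
      have hle := (minpoly.two_le_natDegree_iff hcint).mpr hcnot
      have hle' : (minpoly ℚ (c : AlgebraicClosure ℚ)).natDegree ≤ 2 := by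
        have hd := minpoly.degree_le_of_ne_zero ℚ (c : AlgebraicClosure ℚ) (p := X ^ 2 - C (2 : ℚ))
          (monic_X_pow_sub_C (2 : ℚ) two_ne_zero).ne_zero (by simp [hcQ])
        rw [degree_X_pow_sub_C two_pos] at hd
        exact natDegree_le_iff_degree_le.mpr hd
      omega
    have hdvd : Module.finrank ℚ ↥ℚ⟮(c : AlgebraicClosure ℚ)⟯ ∣ Module.finrank ℚ ℚ⟮θ⟯ :=
      finrank_dvd_of_le_right ((adjoin_simple_le_iff).mpr c.2)
    rw [hdeg2, h3] at hdvd
    omega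
  -- `A = ℚ⟮θ⟯(t')`: every element is a polynomial in `t'` over `ℚ⟮θ⟯`
  have htint : IsIntegral ℚ⟮θ⟯ t' := (Algebra.IsIntegral.isIntegral (R := ℚ) t').tower_top
  have hgen : IntermediateField.adjoin ℚ⟮θ⟯ ({t'} : Set ↥(ℚ⟮θ⟯ ⊔ ((CyclotomicZp.zpExtension 2).layer 1))) = ⊤ := by
    have h2le : 2 ≤ (minpoly ℚ⟮θ⟯ t').natDegree := (minpoly.two_le_natDegree_iff htint).mpr htK
    refine IntermediateField.eq_of_le_of_finrank_eq le_top ?_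
    rw [IntermediateField.adjoin.finrank htint, IntermediateField.finrank_top', hdeg]
    exact le_antisymm ((minpoly.natDegree_le (A := ↥ℚ⟮θ⟯) (x := t')).trans hdeg.le) h2le
  have hpoly : ∀ z : ↥(ℚ⟮θ⟯ ⊔ ((CyclotomicZp.zpExtension 2).layer 1)), ∃ f : ℚ⟮θ⟯[X], z = aeval t' f := by
    intro z
    have hz : z ∈ (IntermediateField.adjoin ℚ⟮θ⟯ ({t'} : Set ↥(ℚ⟮θ⟯ ⊔ ((CyclotomicZp.zpExtension 2).layer 1)))).toSubalgebra := by
      rw [hgen, IntermediateField.top_toSubalgebra]; exact Algebra.mem_top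
    rw [IntermediateField.adjoin_simple_toSubalgebra_of_isAlgebraic htint.isAlgebraic, Algebra.adjoin_singleton_eq_range_aeval] at hz
    obtain ⟨f, hf⟩ := hz
    exact ⟨f, hf.symm⟩
  have hinj : ∀ ρ ρ' : ↥(ℚ⟮θ⟯ ⊔ ((CyclotomicZp.zpExtension 2).layer 1)) →+* ℝ, ρ.comp (algebraMap ℚ⟮θ⟯ ↥(ℚ⟮θ⟯ ⊔ ((CyclotomicZp.zpExtension 2).layer 1))) = ρ'.comp (algebraMap ℚ⟮θ⟯ ↥(ℚ⟮θ⟯ ⊔ ((CyclotomicZp.zpExtension 2).layer 1))) →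
      ρ t' = ρ' t' → ρ = ρ' := by
    intro ρ ρ' hc hval
    refine RingHom.ext fun z => ?_
    obtain ⟨f, rfl⟩ := hpoly z
    rw [aeval_def, hom_eval₂, hom_eval₂, hc, hval]
  -- counting
  have hcardA : Fintype.card (↥(ℚ⟮θ⟯ ⊔ ((CyclotomicZp.zpExtension 2).layer 1)) →+* ℝ) = 6 := by rw [card_realEmbeddings, hfinA]
  haveI : IsTotallyReal ↥ℚ⟮θ⟯ := isTotallyReal_adjoin_d63644 hθ
  have hcardK : Fintype.card (↥ℚ⟮θ⟯ →+* ℝ) = 3 := by rw [card_realEmbeddings, h3]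
  obtain ⟨hs2l, hs2u⟩ := sqrt_two_bounds'
  have hsne : Real.sqrt 2 ≠ -Real.sqrt 2 := by intro h; linarith
  set Φ : (↥(ℚ⟮θ⟯ ⊔ ((CyclotomicZp.zpExtension 2).layer 1)) →+* ℝ) → (↥ℚ⟮θ⟯ →+* ℝ) × ℝ := fun ρ => (ρ.comp (algebraMap ℚ⟮θ⟯ ↥(ℚ⟮θ⟯ ⊔ ((CyclotomicZp.zpExtension 2).layer 1))), ρ t') with hΦ
  set S : Finset ((↥ℚ⟮θ⟯ →+* ℝ) × ℝ) := (Finset.univ : Finset (↥ℚ⟮θ⟯ →+* ℝ)) ×ˢ ({Real.sqrt 2, -Real.sqrt 2} : Finset ℝ) with hS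
  have hΦinj : Function.Injective Φ := fun ρ ρ' h => hinj ρ ρ' (congrArg Prod.fst h) (congrArg Prod.snd h)
  have hsub : Finset.univ.image Φ ⊆ S := by
    intro p hp
    obtain ⟨ρ, -, rfl⟩ := Finset.mem_image.mp hp
    rw [hS, Finset.mem_product]
    refine ⟨Finset.mem_univ _, ?_⟩
    have hsq : (ρ t') ^ 2 = (Real.sqrt 2) ^ 2 := by
      rw [← map_pow, ht'2, map_ofNat, Real.sq_sqrt (by norm_num)]
    rcases sq_eq_sq_iff_eq_or_eq_neg.mp hsq with h | h
    · simp [hΦ, h]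
    · simp [hΦ, h]
  have hcardS : S.card = 6 := by
    rw [hS, Finset.card_product, Finset.card_univ, hcardK, Finset.card_pair hsne]
  have hcardI : (Finset.univ.image Φ).card = 6 := by
    rw [Finset.card_image_of_injective _ hΦinj, Finset.card_univ, hcardA]
  have heq : Finset.univ.image Φ = S := Finset.eq_of_subset_of_card_le hsub (by rw [hcardS, hcardI])
  have hmem : (φ, y) ∈ Finset.univ.image Φ := by
    rw [heq, hS, Finset.mem_product]
    refine ⟨Finset.mem_univ _, ?_⟩
    rcases hy with h | h <;> simp [h]
  obtain ⟨ρ, -, hρ⟩ := Finset.mem_image.mp hmem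
  refine ⟨ρ, fun c => ?_, congrArg Prod.snd hρ⟩
  have h1 := congrArg Prod.fst hρ
  simp only [hΦ] at h1
  rw [← halg, ← RingHom.comp_apply, h1]

set_option maxHeartbeats 400000 in
/-- **`u₀ = 1027839 − 26042θ − 23048θ²` is not the square of a unit of `𝓞 A`, `A = ℚ(θ) ⊔ ℚ_1` (`d = 63644`)**: via the non-trivial automorphism
`σ` of the quadratic extension `A/ℚ(θ)` (`σ√2 = −√2`): `σw = ±w` for a square root `w`; `σw = w` puts `w` in `ℚ(θ)` (excluded by the layer-`0`
certificate `unitCertificate_adjoin_d63644`); `σw = −w` puts `w√2` in `ℚ(θ)` with square `2u₀`, whose `ℚ`-norm is `8·N(u₀) = ±8`, not a rational square.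
Stated for any unit `e` of `𝓞 A` whose value is the image of `u₀`. [cite: Cohen1993, §4.1.3] [cite: FrohlichTaylor1990, Ch. V §1 (1.12), p. 164] -/
theorem not_exists_sq_eq_u0_sup_layer_one_d63644
    (hθ : aeval θ (Cubic.toPoly ⟨1, ((-1 : ℤ) : ℚ), ((-47 : ℤ) : ℚ), ((95 : ℤ) : ℚ)⟩) = 0)
    {t : AlgebraicClosure ℚ} (ht : t ∈ (CyclotomicZp.zpExtension 2).layer 1) (ht2 : t ^ 2 = 2)
    (e : haveI : FiniteDimensional ℚ ↥ℚ⟮θ⟯ :=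
        IntermediateField.adjoin.finiteDimensional ⟨_, Cubic.monic_of_a_eq_one', by rwa [← aeval_def]⟩
      haveI : FiniteDimensional ℚ ↥((CyclotomicZp.zpExtension 2).layer 1) :=
        (CyclotomicZp.zpExtension 2).finiteDimensional_layer_holds 1
      (𝓞 ↥(ℚ⟮θ⟯ ⊔ (CyclotomicZp.zpExtension 2).layer 1))ˣ)
    (he : ((e : 𝓞 ↥(ℚ⟮θ⟯ ⊔ (CyclotomicZp.zpExtension 2).layer 1)) : ↥(ℚ⟮θ⟯ ⊔ (CyclotomicZp.zpExtension 2).layer 1)) =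
      inclusion (le_sup_left : ℚ⟮θ⟯ ≤ ℚ⟮θ⟯ ⊔ (CyclotomicZp.zpExtension 2).layer 1)
        (1027839 - 26042 * AdjoinSimple.gen ℚ θ - 23048 * AdjoinSimple.gen ℚ θ ^ 2)) :
    ¬ ∃ ε : (𝓞 ↥(ℚ⟮θ⟯ ⊔ (CyclotomicZp.zpExtension 2).layer 1))ˣ, e = ε ^ 2 := by
  haveI : FiniteDimensional ℚ ↥ℚ⟮θ⟯ :=
    IntermediateField.adjoin.finiteDimensional ⟨_, Cubic.monic_of_a_eq_one', by rwa [← aeval_def]⟩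
  haveI : FiniteDimensional ℚ ↥((CyclotomicZp.zpExtension 2).layer 1) := (CyclotomicZp.zpExtension 2).finiteDimensional_layer_holds 1
  haveI : NumberField ↥ℚ⟮θ⟯ := NumberField.mk
  haveI : NumberField ↥(ℚ⟮θ⟯ ⊔ (CyclotomicZp.zpExtension 2).layer 1) := NumberField.mk
  obtain ⟨-, hfinA, h3⟩ := layer_one_basics_d63644 hθ
  haveI : IsTotallyReal ↥ℚ⟮θ⟯ := isTotallyReal_adjoin_d63644 hθ
  rintro ⟨ε, hε⟩
  have hKA : ℚ⟮θ⟯ ≤ ℚ⟮θ⟯ ⊔ ((CyclotomicZp.zpExtension 2).layer 1) := le_sup_left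
  have htA : t ∈ ℚ⟮θ⟯ ⊔ ((CyclotomicZp.zpExtension 2).layer 1) := (le_sup_right : ((CyclotomicZp.zpExtension 2).layer 1) ≤ ℚ⟮θ⟯ ⊔ ((CyclotomicZp.zpExtension 2).layer 1)) ht
  set t' : ↥(ℚ⟮θ⟯ ⊔ ((CyclotomicZp.zpExtension 2).layer 1)) := ⟨t, htA⟩ with ht'def
  have ht'2 : t' ^ 2 = 2 := by
    apply (algebraMap ↥(ℚ⟮θ⟯ ⊔ ((CyclotomicZp.zpExtension 2).layer 1)) (AlgebraicClosure ℚ)).injective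
    rw [map_pow, map_ofNat]
    exact ht2
  letI : Algebra ℚ⟮θ⟯ ↥(ℚ⟮θ⟯ ⊔ ((CyclotomicZp.zpExtension 2).layer 1)) := (inclusion hKA).toRingHom.toAlgebra
  have halg : ∀ c : ℚ⟮θ⟯, algebraMap ℚ⟮θ⟯ ↥(ℚ⟮θ⟯ ⊔ ((CyclotomicZp.zpExtension 2).layer 1)) c = inclusion hKA c := fun _ => rfl
  haveI : IsScalarTower ℚ ℚ⟮θ⟯ ↥(ℚ⟮θ⟯ ⊔ ((CyclotomicZp.zpExtension 2).layer 1)) := IsScalarTower.of_algebraMap_eq fun q => ((inclusion hKA).commutes q).symm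
  haveI : Module.Finite ℚ⟮θ⟯ ↥(ℚ⟮θ⟯ ⊔ ((CyclotomicZp.zpExtension 2).layer 1)) := Module.Finite.of_restrictScalars_finite ℚ ℚ⟮θ⟯ _
  have hdeg : Module.finrank ℚ⟮θ⟯ ↥(ℚ⟮θ⟯ ⊔ ((CyclotomicZp.zpExtension 2).layer 1)) = 2 := by
    have htower := Module.finrank_mul_finrank ℚ ℚ⟮θ⟯ ↥(ℚ⟮θ⟯ ⊔ ((CyclotomicZp.zpExtension 2).layer 1))
    rw [h3, hfinA] at htower
    omega
  haveI : Algebra.IsQuadraticExtension ℚ⟮θ⟯ ↥(ℚ⟮θ⟯ ⊔ ((CyclotomicZp.zpExtension 2).layer 1)) := ⟨hdeg⟩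
  haveI : IsGalois ℚ⟮θ⟯ ↥(ℚ⟮θ⟯ ⊔ ((CyclotomicZp.zpExtension 2).layer 1)) := inferInstance
  -- the `ℚ⟮θ⟯`-unit `u₀` (layer-`0` certificate) and its image
  obtain ⟨-, -, -, -, -, -, b, -, eK, -, -, -, -, -, -, -, -, -, hbθ, hb, -, heKb, -, -, -, -, hnsK, -⟩ :=
    unitCertificate_adjoin_d63644 hθ
  have hb' : b ^ 3 - b ^ 2 - 47 * b + 95 = 0 := by push_cast at hb; linear_combination hb
  have hbgen' : algebraMap (𝓞 ↥ℚ⟮θ⟯) ↥ℚ⟮θ⟯ b = AdjoinSimple.gen ℚ θ := hbθ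
  have heKval : ((eK : 𝓞 ℚ⟮θ⟯) : ℚ⟮θ⟯) = 1027839 - 26042 * AdjoinSimple.gen ℚ θ - 23048 * AdjoinSimple.gen ℚ θ ^ 2 := by
    rw [heKb, NumberField.RingOfIntegers.coe_eq_algebraMap]
    simp only [map_sub, map_mul, map_pow, map_ofNat, hbgen']
  set w : ↥(ℚ⟮θ⟯ ⊔ ((CyclotomicZp.zpExtension 2).layer 1)) := ((ε : 𝓞 ↥(ℚ⟮θ⟯ ⊔ ((CyclotomicZp.zpExtension 2).layer 1))) : ↥(ℚ⟮θ⟯ ⊔ ((CyclotomicZp.zpExtension 2).layer 1))) with hwdef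
  have hw2 : w ^ 2 = algebraMap ℚ⟮θ⟯ ↥(ℚ⟮θ⟯ ⊔ ((CyclotomicZp.zpExtension 2).layer 1)) ((eK : 𝓞 ℚ⟮θ⟯) : ℚ⟮θ⟯) := by
    rw [hwdef, heKval, halg, ← he, hε, Units.val_pow_eq_pow_val]; push_cast; ring
  -- the non-trivial automorphism
  have hcard : Fintype.card (↥(ℚ⟮θ⟯ ⊔ ((CyclotomicZp.zpExtension 2).layer 1)) ≃ₐ[ℚ⟮θ⟯] ↥(ℚ⟮θ⟯ ⊔ ((CyclotomicZp.zpExtension 2).layer 1))) = 2 := by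
    rw [← Nat.card_eq_fintype_card, IsGalois.card_aut_eq_finrank, hdeg]
  haveI : Nontrivial (↥(ℚ⟮θ⟯ ⊔ ((CyclotomicZp.zpExtension 2).layer 1)) ≃ₐ[ℚ⟮θ⟯] ↥(ℚ⟮θ⟯ ⊔ ((CyclotomicZp.zpExtension 2).layer 1))) := Fintype.one_lt_card_iff_nontrivial.mp (by rw [hcard]; norm_num)
  obtain ⟨σ, hσ1⟩ := exists_ne (1 : ↥(ℚ⟮θ⟯ ⊔ ((CyclotomicZp.zpExtension 2).layer 1)) ≃ₐ[ℚ⟮θ⟯] ↥(ℚ⟮θ⟯ ⊔ ((CyclotomicZp.zpExtension 2).layer 1)))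
  have hall : ∀ f : ↥(ℚ⟮θ⟯ ⊔ ((CyclotomicZp.zpExtension 2).layer 1)) ≃ₐ[ℚ⟮θ⟯] ↥(ℚ⟮θ⟯ ⊔ ((CyclotomicZp.zpExtension 2).layer 1)), f = 1 ∨ f = σ := by
    intro f
    by_contra hf
    push Not at hf
    have h3' : ({1, σ, f} : Finset (↥(ℚ⟮θ⟯ ⊔ ((CyclotomicZp.zpExtension 2).layer 1)) ≃ₐ[ℚ⟮θ⟯] ↥(ℚ⟮θ⟯ ⊔ ((CyclotomicZp.zpExtension 2).layer 1)))).card = 3 := by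
      rw [Finset.card_insert_of_notMem, Finset.card_pair hf.2.symm]
      simp only [Finset.mem_insert, Finset.mem_singleton, not_or]
      exact ⟨hσ1.symm, hf.1.symm⟩
    have := Finset.card_le_univ ({1, σ, f} : Finset (↥(ℚ⟮θ⟯ ⊔ ((CyclotomicZp.zpExtension 2).layer 1)) ≃ₐ[ℚ⟮θ⟯] ↥(ℚ⟮θ⟯ ⊔ ((CyclotomicZp.zpExtension 2).layer 1))))
    rw [h3', hcard] at this
    omega
  have hfix : ∀ z : ↥(ℚ⟮θ⟯ ⊔ ((CyclotomicZp.zpExtension 2).layer 1)), σ z = z → z ∈ Set.range (algebraMap ℚ⟮θ⟯ ↥(ℚ⟮θ⟯ ⊔ ((CyclotomicZp.zpExtension 2).layer 1))) := by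
    intro z hz
    refine (IsGalois.mem_range_algebraMap_iff_fixed z).mpr fun f => ?_
    rcases hall f with rfl | rfl
    · rfl
    · exact hz
  -- `t' ∉ ℚ⟮θ⟯`, `A = ℚ⟮θ⟯(t')`, `σ t' = −t'`
  have htK : t' ∉ Set.range (algebraMap ℚ⟮θ⟯ ↥(ℚ⟮θ⟯ ⊔ ((CyclotomicZp.zpExtension 2).layer 1))) := by
    rintro ⟨c, hc⟩
    obtain ⟨ρ, hρK, hρt⟩ := exists_ringHom_sup_layer_one_d63644 hθ ht ht2
      (InfinitePlace.embedding_of_isReal (IsTotallyReal.isReal (Classical.arbitrary (InfinitePlace ℚ⟮θ⟯)))) (Real.sqrt 2) (Or.inl rfl)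
    obtain ⟨ρ', hρ'K, hρ't⟩ := exists_ringHom_sup_layer_one_d63644 hθ ht ht2
      (InfinitePlace.embedding_of_isReal (IsTotallyReal.isReal (Classical.arbitrary (InfinitePlace ℚ⟮θ⟯)))) (-Real.sqrt 2) (Or.inr rfl)
    have h1 : ρ t' = ρ' t' := by rw [← hc, halg, hρK, hρ'K]
    rw [hρt, hρ't] at h1
    have := sqrt_two_bounds'; linarith [this.1]
  have htint : IsIntegral ℚ⟮θ⟯ t' := (Algebra.IsIntegral.isIntegral (R := ℚ) t').tower_top
  have hgen : IntermediateField.adjoin ℚ⟮θ⟯ ({t'} : Set ↥(ℚ⟮θ⟯ ⊔ ((CyclotomicZp.zpExtension 2).layer 1))) = ⊤ := by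
    have h2le : 2 ≤ (minpoly ℚ⟮θ⟯ t').natDegree := (minpoly.two_le_natDegree_iff htint).mpr htK
    refine IntermediateField.eq_of_le_of_finrank_eq le_top ?_
    rw [IntermediateField.adjoin.finrank htint, IntermediateField.finrank_top', hdeg]
    exact le_antisymm ((minpoly.natDegree_le (A := ↥ℚ⟮θ⟯) (x := t')).trans hdeg.le) h2le
  have hpoly : ∀ z : ↥(ℚ⟮θ⟯ ⊔ ((CyclotomicZp.zpExtension 2).layer 1)), ∃ f : ℚ⟮θ⟯[X], z = aeval t' f := by
    intro z
    have hz : z ∈ (IntermediateField.adjoin ℚ⟮θ⟯ ({t'} : Set ↥(ℚ⟮θ⟯ ⊔ ((CyclotomicZp.zpExtension 2).layer 1)))).toSubalgebra := by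
      rw [hgen, IntermediateField.top_toSubalgebra]; exact Algebra.mem_top
    rw [IntermediateField.adjoin_simple_toSubalgebra_of_isAlgebraic htint.isAlgebraic, Algebra.adjoin_singleton_eq_range_aeval] at hz
    obtain ⟨f, hf⟩ := hz
    exact ⟨f, hf.symm⟩
  have hσt : σ t' = -t' := by
    have hsq : (σ t') ^ 2 = t' ^ 2 := by rw [← map_pow, ht'2, map_ofNat]
    rcases sq_eq_sq_iff_eq_or_eq_neg.mp hsq with h | h
    · exfalso
      apply hσ1
      refine AlgEquiv.ext fun z => ?_
      obtain ⟨f, rfl⟩ := hpoly z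
      rw [AlgEquiv.one_apply, ← Polynomial.aeval_algHom_apply, h]
    · exact h
  have hσw : σ w = w ∨ σ w = -w := by
    have hsq : (σ w) ^ 2 = w ^ 2 := by rw [← map_pow, hw2, AlgEquiv.commutes]
    exact sq_eq_sq_iff_eq_or_eq_neg.mp hsq
  rcases hσw with h | h
  · -- `w ∈ ℚ⟮θ⟯`: a unit square root of `b² − 2` in `𝓞 ℚ⟮θ⟯`
    obtain ⟨c, hc⟩ := hfix w h
    have hc2 : c ^ 2 = ((eK : 𝓞 ℚ⟮θ⟯) : ℚ⟮θ⟯) := by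
      apply (algebraMap ℚ⟮θ⟯ ↥(ℚ⟮θ⟯ ⊔ ((CyclotomicZp.zpExtension 2).layer 1))).injective; rw [map_pow, hc, hw2]
    have hcint : IsIntegral ℤ c := by
      refine IsIntegral.of_pow two_pos ?_
      rw [hc2]; exact (eK : 𝓞 ℚ⟮θ⟯).2
    set c' : 𝓞 ℚ⟮θ⟯ := ⟨c, hcint⟩ with hc'def
    have hc'2 : c' ^ 2 = (eK : 𝓞 ℚ⟮θ⟯) := by ext; simp [hc'def, hc2]
    have hcu : c' * (c' * (15044119 - 9513134 * b + 1150764 * b ^ 2)) = 1 := by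
      rw [← mul_assoc, ← sq, hc'2, heKb]
      linear_combination ((162767707672 : 𝓞 ↥ℚ⟮θ⟯) + (-26522808672 : 𝓞 ↥ℚ⟮θ⟯) * b) * hb'
    exact hnsK ⟨Units.mkOfMulEqOne c' _ hcu,
      Units.ext (by rw [Units.val_pow_eq_pow_val, Units.val_mkOfMulEqOne (a := c'), hc'2])⟩
  · -- `w t' ∈ ℚ⟮θ⟯` with square `2 u₀`: norm obstruction
    have hfix' : σ (w * t') = w * t' := by rw [map_mul, h, hσt]; ring
    obtain ⟨c, hc⟩ := hfix (w * t') hfix'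
    have hc2 : c ^ 2 = 2 * ((eK : 𝓞 ℚ⟮θ⟯) : ℚ⟮θ⟯) := by
      apply (algebraMap ℚ⟮θ⟯ ↥(ℚ⟮θ⟯ ⊔ ((CyclotomicZp.zpExtension 2).layer 1))).injective
      rw [map_pow, hc, mul_pow, hw2, ht'2, map_mul, map_ofNat]; ring
    have hN := congrArg (Algebra.norm ℚ) hc2
    rw [map_pow, map_mul, show (2 : ℚ⟮θ⟯) = algebraMap ℚ ℚ⟮θ⟯ 2 from (map_ofNat _ 2).symm, Algebra.norm_algebraMap, h3,
      ← Algebra.coe_norm_int] at hN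
    have hunit : IsUnit (Algebra.norm ℤ (eK : 𝓞 ℚ⟮θ⟯)) := eK.isUnit.map _
    rcases Int.isUnit_iff.mp hunit with h1 | h1
    · rw [h1] at hN; norm_num at hN; exact rat_sq_ne_eight _ hN
    · rw [h1] at hN; norm_num at hN; nlinarith [sq_nonneg (Algebra.norm ℚ c)]


end Summit.BirchSwinnertonDyer.BirchSwinnertonDyer.Theorems.AddKatoTwo

end
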